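import Literature.AnabelianGeometry.AbsoluteAnabelian.ArchimedeanHolGroupPairsHomProofs
import Literature.AnabelianGeometry.AbsoluteAnabelian.ArchimedeanHolGroupPairsLambda
import Mathlib.CategoryTheory.InducedCategory
import HarnessLib

/-!
# No `⊞`-arrow along the space-link inclusion `k^× ↪ k` in `𝒞^hol_{TH⊞}` ([AbsTopIII] Def. 5.4 (v))

Layer `Literature/AnabelianGeometry/AbsoluteAnabelian`, PROOF-ONLY (abc-iut cell, seat abc-iut-L4-t8; sequel to
`ArchimedeanHolGroupPairsHomProofs`).  S. Mochizuki, *Topics in Absolute Anabelian Geometry III*, Def. 5.4 (v)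
p. 127, on the archimedean diagram `k~ →(id) k~ →(shell) k^× ↪ k`:

> «Observe that the entire diagram `Γ⃗^log_arc` may be considered as a diagram in the category `TH`, whereas
> the diagram `Γ⃗⋉_arc` [obtained by removing the arrow "`↪ k`" on the right] may be considered either as a
> diagram in the category `TH` or as a diagram in `TH⊞` [i.e., relative to the additive topological group
> structure of the field `k~`].» (p. 127)

At the level of the underlying maps of the `ℂ`-model this observation is `ComplexLogShell.spaceLinkArrow_not_hom`
(`LogShellsArchClausesProofs`: the inclusion does not carry products to sums, `1·1 ≠ 1 + 1`).  This file proves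
the STRONGER statement at the level of the typed category `𝒞^hol_{TH⊞}` (`HolTHPlusPair 𝔄`,
`ArchimedeanHolGroupPairs`): not only is the inclusion `k^× ↪ k` not a `TH⊞`-arrow — there is NO morphism of
`𝒞^hol_{TH⊞}` AT ALL from an object of shape `times` (the multiplicative group `λ⊞^×(𝕏)`) to an object of shape
`sim` (the additive group `λ⊞^∼(𝕐)`), over any base arrow and for any Kummer-compatible candidate
(`THPlusShape.false_of_times_sim`, `ArchimedeanHolGroupPairsHomProofs`: a Kummer-compatible continuous
homomorphism `k^× → (k′, +)` would be a homomorphic logarithm, and `(-1)² = 1` forces `σ(-1) = exp 0 = 1`).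

* ★ `HolTHPlusPair.isEmpty_hom_of_times_sim` — `Hom(P, Q) = ∅` whenever `P.shape = times`, `Q.shape = sim`;
* `HolTHPlusPair.isEmpty_natTrans_of_shapes`, `HolTHPlusPair.isEmpty_natTrans_induced` — hence no natural
  transformation `F → G` between functors (into `𝒞^hol_{TH⊞}`, or into any induced category over it, e.g. a
  universe lift) that at one object land in a `times`-, resp. `sim`-shape object;
* `HolTFPair.lamTimesPlus_obj_shape`, `HolTFPair.lamSimPlus_obj_shape` (`rfl`), and
  ★ `HolTFPair.isEmpty_lamTimesPlus_hom_lamSimPlus` — for every endofunctor `Λ` of `𝒞^hol_TF` (any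
  "Frobenius twist"), `(Λ ⋙ λ⊞^×) ⟶ λ⊞^∼` is EMPTY as soon as `𝒞^hol_TF` has an object.

DESIGN CONSEQUENCE (cell note, not print): an instance of the §5 interface `LogFrobeniusSetting` whose `𝒩⊞_v` at
an archimedean `v` is (a lift of) `𝒞^hol_{TH⊞}` with `λ⊞_{v,mult} = λ⊞^×` and `λ⊞_{v,space-link} = λ⊞^∼` cannot
supply the datum `ι⊞_{v,ε}` for `ε = (k^× ↪ k)`; in accordance with print, only the sub-diagram `Γ⃗⋉_arc`
(`k~ →(id) k~`, and the shell arrow, typed as `HolTFPair.iotaTimesPlus : λ⊞^∼ ⟶ λ⊞^×` in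
`ArchimedeanHolGroupPairsLambda`) carries `TH⊞`-structure, while `Γ⃗^log_arc` is a `TH`-diagram
(`HolTFPair.inclTimes` in `𝒞^hol_TH`).

Refereed pre-IUT material; classical; nothing here bears on [IUTchIII] Cor. 3.12; no side taken.
-/

open CategoryTheory

universe u

namespace Literature.AnabelianGeometry.AbsoluteAnabelian

section Aux

variable {k k' A A' B B' : Type u} [NormedField k] [NormedField k'] [NormedField A] [NormedField A']
  [AddCommGroup B] [TopologicalSpace B] [AddCommGroup B'] [TopologicalSpace B']

/-- `THPlusShape.false_of_times_sim` with the shapes as variables constrained by equations (so that it can be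
instantiated at the dependent data of two objects of `𝒞^hol_{TH⊞}`). [folklore] -/
private theorem false_of_compat_aux [CharZero k] [CharZero k'] (hk' : IsCAF k') (s s' : THPlusShape)
    (hs : s = .times) (hs' : s' = .sim) (c : k ≃+* A) (c' : k' ≃+* A') (α : A ≃+* A')
    (pres : B ≃ₜ s.carrier k)
    (hadd : ∀ a b : B, ((pres (a + b) : s.carrier k) : k) = s.op (pres a : k) (pres b : k))
    (pres' : B' ≃ₜ s'.carrier k')
    (hadd' : ∀ a b : B', ((pres' (a + b) : s'.carrier k') : k') = s'.op (pres' a : k') (pres' b : k'))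
    (φ : B →ₜ+ B') (hφ : ∀ b, s'.kummer c' (pres' (φ b) : k') = α (s.kummer c (pres b : k))) :
    False := by
  subst hs hs'
  exact false_of_times_sim c c' α φ hk' pres hadd pres' hadd' hφ

end Aux

namespace HolTHPlusPair

variable {𝔄 : AutHolFieldFunctor.{u}}

/-- ★ **No arrow `k^× → k` in `𝒞^hol_{TH⊞}`**: there is no morphism from an object of shape `times`
(multiplicative group of a CAF) to an object of shape `sim` (additive group of a CAF) — the space-link
inclusion `k^× ↪ k` of `Γ⃗^log_arc` is not a `TH⊞`-arrow. [cite: MochizukiAbsTopIII2015, Definition 5.4 (v) p.127] -/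
theorem isEmpty_hom_of_times_sim {P Q : HolTHPlusPair 𝔄} (hP : P.shape = .times) (hQ : Q.shape = .sim) :
    IsEmpty (P ⟶ Q) :=
  ⟨fun φ => @false_of_compat_aux P.k Q.k (𝔄.A P.X) (𝔄.A Q.X) P.B Q.B _ _ _ _ _ _ _ _ P.charZero_k
    Q.charZero_k Q.isCAF P.shape Q.shape hP hQ P.c Q.c (𝔄.Amap φ.base) P.pres P.pres_add Q.pres Q.pres_add
    φ.arith (fun b => (Q.κ_def _).symm.trans ((φ.compat b).trans (congrArg _ (P.κ_def _))))⟩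

/-- No natural transformation `F → G` between functors into `𝒞^hol_{TH⊞}` which, at some object `X`, take a
`times`-shape, resp. a `sim`-shape value. [cite: MochizukiAbsTopIII2015, Definition 5.4 (v) p.127] -/
theorem isEmpty_natTrans_of_shapes {C : Type*} [Category C] (F G : C ⥤ HolTHPlusPair 𝔄) (X : C)
    (hF : (F.obj X).shape = .times) (hG : (G.obj X).shape = .sim) : IsEmpty (F ⟶ G) :=
  ⟨fun η => (isEmpty_hom_of_times_sim hF hG).false (η.app X)⟩

/-- The same for functors into any induced category over `𝒞^hol_{TH⊞}` (e.g. a universe lift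
`InducedCategory (HolTHPlusPair 𝔄) ULift.down`). [cite: MochizukiAbsTopIII2015, Definition 5.4 (v) p.127] -/
theorem isEmpty_natTrans_induced {D : Type*} (p : D → HolTHPlusPair 𝔄) {C : Type*} [Category C]
    (F G : C ⥤ InducedCategory (HolTHPlusPair 𝔄) p) (X : C)
    (hF : (p (F.obj X)).shape = .times) (hG : (p (G.obj X)).shape = .sim) : IsEmpty (F ⟶ G) :=
  ⟨fun η => (isEmpty_hom_of_times_sim hF hG).false (η.app X).hom⟩

end HolTHPlusPair

namespace HolTFPair

variable (𝔄 : AutHolFieldFunctor.{u})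

/-- `λ⊞^×` takes `times`-shape values. [cite: MochizukiAbsTopIII2015, Definition 5.4 (vi) p.128] -/
theorem lamTimesPlus_obj_shape (X : HolTFPair 𝔄) : ((lamTimesPlus 𝔄).obj X).shape = .times := rfl

/-- `λ⊞^∼` takes `sim`-shape values. [cite: MochizukiAbsTopIII2015, Definition 5.4 (vi) p.128] -/
theorem lamSimPlus_obj_shape (X : HolTFPair 𝔄) : ((lamSimPlus 𝔄).obj X).shape = .sim := rfl

/-- ★ **No `ι⊞` along the space-link arrow**: for every endofunctor `Λ` of `𝒞^hol_TF` there is no natural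
transformation `Λ ⋙ λ⊞^× → λ⊞^∼` (as soon as `𝒞^hol_TF` has an object) — the arrow `k^× ↪ k` of `Γ⃗^log_arc`
lives in `TH` (`HolTFPair.inclTimes`), not in `TH⊞`. [cite: MochizukiAbsTopIII2015, Definition 5.4 (v) p.127] -/
theorem isEmpty_lamTimesPlus_hom_lamSimPlus [Nonempty (HolTFPair 𝔄)] (Λ : HolTFPair 𝔄 ⥤ HolTFPair 𝔄) :
    IsEmpty (Λ ⋙ lamTimesPlus 𝔄 ⟶ lamSimPlus 𝔄) :=
  HolTHPlusPair.isEmpty_natTrans_of_shapes _ _ (Classical.arbitrary (HolTFPair 𝔄))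
    (lamTimesPlus_obj_shape 𝔄 _) (lamSimPlus_obj_shape 𝔄 _)

/-- The un-twisted case `Λ = 𝟭`: no natural transformation `λ⊞^× → λ⊞^∼`.
[cite: MochizukiAbsTopIII2015, Definition 5.4 (v) p.127] -/
theorem isEmpty_lamTimesPlus_hom_lamSimPlus' [Nonempty (HolTFPair 𝔄)] :
    IsEmpty (lamTimesPlus 𝔄 ⟶ lamSimPlus 𝔄) :=
  HolTHPlusPair.isEmpty_natTrans_of_shapes _ _ (Classical.arbitrary (HolTFPair 𝔄))
    (lamTimesPlus_obj_shape 𝔄 _) (lamSimPlus_obj_shape 𝔄 _)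

end HolTFPair

end Literature.AnabelianGeometry.AbsoluteAnabelian
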